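import Summits.CriticalPhenomena.SAWScalingLimit.Theorems.SAWDevelopingMapObservableToSLETypeLadderCarvedReductionSqueezeGateStructure
import Summits.CriticalPhenomena.SAWScalingLimit.Theorems.SAWDevelopingMapObservableToSLETypeLadderCarvedReductionSqueezeGateBounds
import Summits.CriticalPhenomena.SAWScalingLimit.Theorems.SAWDevelopingMapObservableToSLETypeLadderCarvedReductionSqueezeMultiLimits
import HarnessLib

/-!
# The closed limit hexagons COVER the limits of the removed vertices, and are covered by them
# (piece (T-A′₂ cover) of stub T-A′₂ `stub_carvedReduction_squeezeGeometry_domainsCore`)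

Crux `SAWDevelopingMap.ObservableToSLE` (stmt-CriticalPhenomena-10472), line `six-class-type-ladder`,
stub T-A′₂ `stub_carvedReduction_squeezeGeometry_domainsCore` (the continuum geometry of the pinned frame
from the confined outer approximants).  Landing target:
`Summits/CriticalPhenomena/SAWScalingLimit/Theorems/SAWDevelopingMapObservableToSLETypeLadderCarvedReductionSqueezeLimitCover.lean`.

Inputs are the clauses of THE LIMIT PACKAGE `TypeLadder.squeeze_limitPackage` (p141874) in the pinned
frame `v ↦ s_j c_v - s_j · triEmbed x_j` at one removed level `U j` (a union of `N` tracked cells with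
closed limit hexagons `Hex_i = {z | ∀ ℓ, |skewCoord ℓ (z - C i)| ≤ ϱ i}`):
* `mem_limitHex_of_frequently_near` — (CONTAINMENT ⇒) a point approached, along infinitely many
  levels, by pinned removed vertices lies in some closed limit hexagon;
* `mem_limitHex_of_eventually_removed_near` — hence every point a fixed neighbourhood of which is
  eventually fully removed lies in `⋃ Hex_i`; corollaries `mem_limitHex_of_persistent_infDist`
  (points at `infDist < m` from a set whose `(m - ε)`-neighbourhoods are persistently removed: the
  spine/body cores) and `mem_limitHex_of_lowerHalfWindow` (the open lower half-ball of an exact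
  window);
* `eventually_near_removed_of_mem_limitHex` — (PERSISTENCE + centres ⇒) conversely, for every
  `ε > 0`, eventually every point of every closed limit hexagon is within `ε` of a pinned removed
  vertex (uniformly in the point and the cell).
These are the two halves of "`⋃ Hex_i` is the Hausdorff limit of the pinned removed level", in the
pointwise forms used to place the bulk `Ω` and the continuum paths of the squeeze (T-A′₂).
Registered carrier: `stub_carvedReduction_limitCover`.
-/

noncomputable section

open scoped Topology
open Filter Set Metric
open Literature.Probability.LatticeModels (HexVertex hexGraph hexCenter triEmbed Site)
open Literature.Probability.RandomPlanarGeometry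

namespace Summit.CriticalPhenomena.SAWScalingLimit.Theorems.ObservableToSLE.TypeLadder

open Summit.CriticalPhenomena.SAWScalingLimit.Theorems.ObservableToSLER.BridgeGate

section Cover

variable {N : ℕ} {s : ℕ → ℝ} {x : ℕ → Site 2} {U : ℕ → Set HexVertex} {C : Fin N → ℂ} {ϱ : Fin N → ℝ}

/-- Skew coordinates of a difference split along an intermediate point, with the `2·dist` bound. -/
theorem abs_skewCoord_sub_le_add (ℓ : Fin 3) (z w c : ℂ) :
    |skewCoord ℓ (z - c)| ≤ |skewCoord ℓ (w - c)| + 2 * dist w z := by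
  have hsplit : skewCoord ℓ (z - c) = skewCoord ℓ (w - c) + skewCoord ℓ (z - w) := by
    rw [← skewCoord_add]; congr 1; ring
  have hb : |skewCoord ℓ (z - w)| ≤ 2 * dist w z := by
    rw [dist_comm, dist_eq_norm]; exact abs_skewCoord_le ℓ (z - w)
  rw [hsplit]
  exact (abs_add_le _ _).trans (by linarith)

/-- **CONTAINMENT ⇒ limits of removed vertices lie in the closed limit hexagons.**  If for every
`ε > 0` the removed level is eventually inside the `ε`-thickened limit hexagons, then every point
`z` which, for every `ε > 0`, is `ε`-close to a pinned removed vertex at infinitely many levels,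
lies in one of the closed limit hexagons. -/
theorem mem_limitHex_of_frequently_near
    (hcont : ∀ ε > (0 : ℝ), ∀ᶠ j in atTop, ∀ v ∈ U j, ∃ i : Fin N, ∀ ℓ : Fin 3,
      |skewCoord ℓ ((s j : ℂ) * hexCenter v - (s j : ℂ) * triEmbed (x j) - C i)| ≤ ϱ i + ε)
    {z : ℂ} (hz : ∀ ε > (0 : ℝ), ∃ᶠ j in atTop, ∃ v ∈ U j,
      dist ((s j : ℂ) * hexCenter v - (s j : ℂ) * triEmbed (x j)) z < ε) :
    ∃ i : Fin N, ∀ ℓ : Fin 3, |skewCoord ℓ (z - C i)| ≤ ϱ i := by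
  -- for every `ε > 0` some cell's hexagon contains `z` up to `3 ε`
  have key : ∀ ε > (0 : ℝ), ∃ i : Fin N, ∀ ℓ : Fin 3, |skewCoord ℓ (z - C i)| ≤ ϱ i + 3 * ε := by
    intro ε hε
    obtain ⟨j, ⟨v, hvU, hvz⟩, hj⟩ := ((hz ε hε).and_eventually (hcont ε hε)).exists
    obtain ⟨i, hi⟩ := hj v hvU
    refine ⟨i, fun ℓ => ?_⟩
    have := abs_skewCoord_sub_le_add ℓ z ((s j : ℂ) * hexCenter v - (s j : ℂ) * triEmbed (x j)) (C i)
    linarith [hi ℓ]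
  by_contra h
  push Not at h
  choose ℓ hℓ using h
  obtain ⟨m, hm, hmle⟩ := exists_min_pos (fun i => |skewCoord (ℓ i) (z - C i)| - ϱ i) fun i => by
    linarith [hℓ i]
  obtain ⟨i, hi⟩ := key (m / 4) (by positivity)
  have h1 := hi (ℓ i)
  have h2 := hmle i
  linarith

/-- **A point a fixed neighbourhood of which is eventually fully removed lies in `⋃ Hex_i`.** -/
theorem mem_limitHex_of_eventually_removed_near (hs : ∀ j, 0 < s j) (hs0 : Tendsto s atTop (𝓝 0))
    (hcont : ∀ ε > (0 : ℝ), ∀ᶠ j in atTop, ∀ v ∈ U j, ∃ i : Fin N, ∀ ℓ : Fin 3,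
      |skewCoord ℓ ((s j : ℂ) * hexCenter v - (s j : ℂ) * triEmbed (x j) - C i)| ≤ ϱ i + ε)
    {z : ℂ} {η : ℝ} (hη : 0 < η)
    (hrem : ∀ᶠ j in atTop, ∀ v : HexVertex,
      dist ((s j : ℂ) * hexCenter v - (s j : ℂ) * triEmbed (x j)) z < η → v ∈ U j) :
    ∃ i : Fin N, ∀ ℓ : Fin 3, |skewCoord ℓ (z - C i)| ≤ ϱ i := by
  refine mem_limitHex_of_frequently_near hcont fun ε hε => ?_
  have h1 : ∀ᶠ j in atTop, 2 * s j < min ε η := by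
    have : Tendsto (fun j => 2 * s j) atTop (𝓝 (2 * 0)) := hs0.const_mul 2
    rw [mul_zero] at this
    exact this.eventually (gt_mem_nhds (lt_min hε hη))
  refine (h1.and hrem).frequently.mono fun j ⟨hj1, hj2⟩ => ?_
  -- the nearest up-face to `z + s_j · triEmbed x_j`
  obtain ⟨v, hv⟩ := exists_vertex_near (z + (s j : ℂ) * triEmbed (x j)) (hs j)
  have hd : dist ((s j : ℂ) * hexCenter v - (s j : ℂ) * triEmbed (x j)) z ≤ 2 * s j := by
    have : dist ((s j : ℂ) * hexCenter v - (s j : ℂ) * triEmbed (x j)) z =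
        dist ((s j : ℂ) * hexCenter v) (z + (s j : ℂ) * triEmbed (x j)) := by
      rw [dist_eq_norm, dist_eq_norm]; congr 1; ring
    rw [this]; exact hv
  exact ⟨v, hj2 v (by linarith [min_le_right ε η]), by linarith [min_le_left ε η]⟩

/-- **Persistently removed neighbourhoods lie in `⋃ Hex_i`**: if for every `ε > 0`, eventually,
every vertex pinned within `m - ε` of `B` is removed, then every point at `infDist < m` from
`B` lies in a closed limit hexagon (the `ρ/8`-cores of the spines, the `ρ/4`-cores
of the bodies). -/
theorem mem_limitHex_of_persistent_infDist (hs : ∀ j, 0 < s j) (hs0 : Tendsto s atTop (𝓝 0))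
    (hcont : ∀ ε > (0 : ℝ), ∀ᶠ j in atTop, ∀ v ∈ U j, ∃ i : Fin N, ∀ ℓ : Fin 3,
      |skewCoord ℓ ((s j : ℂ) * hexCenter v - (s j : ℂ) * triEmbed (x j) - C i)| ≤ ϱ i + ε)
    {B : Set ℂ} {m : ℝ}
    (hper : ∀ ε > (0 : ℝ), ∀ᶠ j in atTop, ∀ v : HexVertex,
      infDist ((s j : ℂ) * hexCenter v - (s j : ℂ) * triEmbed (x j)) B ≤ m - ε → v ∈ U j)
    {z : ℂ} (hz : infDist z B < m) :
    ∃ i : Fin N, ∀ ℓ : Fin 3, |skewCoord ℓ (z - C i)| ≤ ϱ i := by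
  set η : ℝ := (m - infDist z B) / 2 with hη
  have hη0 : 0 < η := by rw [hη]; linarith
  refine mem_limitHex_of_eventually_removed_near hs hs0 hcont hη0 ?_
  filter_upwards [hper η hη0] with j hj v hv
  refine hj v ?_
  have h1 : infDist ((s j : ℂ) * hexCenter v - (s j : ℂ) * triEmbed (x j)) B ≤
      infDist z B + dist ((s j : ℂ) * hexCenter v - (s j : ℂ) * triEmbed (x j)) z :=
    infDist_le_infDist_add_dist
  have : infDist z B = m - 2 * η := by rw [hη]; ring
  linarith

/-- **The open lower half-ball of an exact window lies in `⋃ Hex_i`**: if the removed level is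
exact in the pinned window at `P` of radius `r` (rows below the gate row are removed, the pinned
gates converging to `P`), every `z` with `dist z P < r` and `im z < im P` lies in a closed limit
hexagon. -/
theorem mem_limitHex_of_lowerHalfWindow (hs : ∀ j, 0 < s j) (hs0 : Tendsto s atTop (𝓝 0))
    (hcont : ∀ ε > (0 : ℝ), ∀ᶠ j in atTop, ∀ v ∈ U j, ∃ i : Fin N, ∀ ℓ : Fin 3,
      |skewCoord ℓ ((s j : ℂ) * hexCenter v - (s j : ℂ) * triEmbed (x j) - C i)| ≤ ϱ i + ε)
    {q : ℕ → HexVertex} {P : ℂ} {r : ℝ}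
    (hconv : Tendsto (fun j => (s j : ℂ) * hexCenter (((q j).1 - x j, 0) : HexVertex)) atTop (𝓝 P))
    (hU : ∀ᶠ j in atTop, ∀ v : HexVertex,
      (s j : ℂ) * hexCenter v - (s j : ℂ) * triEmbed (x j) ∈ ball P r → (v ∈ U j ↔ v.1 1 < (q j).1 1))
    {z : ℂ} (hz : dist z P < r) (hzim : z.im < P.im) :
    ∃ i : Fin N, ∀ ℓ : Fin 3, |skewCoord ℓ (z - C i)| ≤ ϱ i := by
  set η : ℝ := min ((r - dist z P) / 2) ((P.im - z.im) / 2) with hη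
  have hη0 : 0 < η := lt_min (by linarith) (by linarith)
  have hηr : η ≤ (r - dist z P) / 2 := min_le_left _ _
  have hηi : η ≤ (P.im - z.im) / 2 := min_le_right _ _
  refine mem_limitHex_of_eventually_removed_near hs hs0 hcont hη0 ?_
  have hgate : ∀ᶠ j in atTop, z.im + η < ((s j : ℂ) * hexCenter (((q j).1 - x j, 0) : HexVertex)).im :=
    (Complex.continuous_im.tendsto P |>.comp hconv).eventually (lt_mem_nhds (by linarith))
  filter_upwards [hU, gate_present_above hs hU, hgate] with j hj hpres hg v hv
  have hball : (s j : ℂ) * hexCenter v - (s j : ℂ) * triEmbed (x j) ∈ ball P r := by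
    rw [mem_ball]
    calc dist ((s j : ℂ) * hexCenter v - (s j : ℂ) * triEmbed (x j)) P
        ≤ dist ((s j : ℂ) * hexCenter v - (s j : ℂ) * triEmbed (x j)) z + dist z P := dist_triangle _ _ _
      _ < r := by linarith
  by_contra hvU
  have h1 := hpres v hball hvU
  have h2 : ((s j : ℂ) * hexCenter v - (s j : ℂ) * triEmbed (x j)).im < z.im + η := by
    have := Complex.abs_im_le_norm (((s j : ℂ) * hexCenter v - (s j : ℂ) * triEmbed (x j)) - z)
    rw [← dist_eq_norm] at this
    rw [Complex.sub_im] at this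
    linarith [le_abs_self ((((s j : ℂ) * hexCenter v - (s j : ℂ) * triEmbed (x j))).im - z.im)]
  linarith

/-- **PERSISTENCE + centres ⇒ every point of a closed limit hexagon is eventually `ε`-close to a
pinned removed vertex**, uniformly in the point and the cell: the centre handles small hexagons,
a homothety towards the centre followed by the nearest lattice face handles the others. -/
theorem eventually_near_removed_of_mem_limitHex (hs : ∀ j, 0 < s j) (hs0 : Tendsto s atTop (𝓝 0))
    (hpers : ∀ ε > (0 : ℝ), ∀ᶠ j in atTop, ∀ (i : Fin N) (v : HexVertex),
      (∀ ℓ : Fin 3, |skewCoord ℓ ((s j : ℂ) * hexCenter v - (s j : ℂ) * triEmbed (x j) - C i)| ≤ ϱ i - ε) →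
        v ∈ U j)
    {t : ℕ → Fin N → HexVertex} (ht : ∀ᶠ j in atTop, ∀ i, t j i ∈ U j)
    (hC : ∀ i, Tendsto (fun j => (s j : ℂ) * hexCenter (t j i) - (s j : ℂ) * triEmbed (x j)) atTop (𝓝 (C i))) :
    ∀ ε > (0 : ℝ), ∀ᶠ j in atTop, ∀ (i : Fin N) (z : ℂ), (∀ ℓ : Fin 3, |skewCoord ℓ (z - C i)| ≤ ϱ i) →
      ∃ v ∈ U j, dist ((s j : ℂ) * hexCenter v - (s j : ℂ) * triEmbed (x j)) z < ε := by
  intro ε hε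
  set ε' : ℝ := ε / 16 with hε'
  have hε'0 : 0 < ε' := by positivity
  have hcen : ∀ᶠ j in atTop, ∀ i, dist ((s j : ℂ) * hexCenter (t j i) - (s j : ℂ) * triEmbed (x j)) (C i) < ε' := by
    rw [eventually_all]
    exact fun i => Metric.tendsto_nhds.1 (hC i) ε' hε'0
  have hsj : ∀ᶠ j in atTop, 4 * s j < ε' := by
    have : Tendsto (fun j => 4 * s j) atTop (𝓝 (4 * 0)) := hs0.const_mul 4
    rw [mul_zero] at this
    exact this.eventually (gt_mem_nhds hε'0)
  filter_upwards [hcen, hsj, hpers ε' hε'0, ht] with j hjc hjs hjp hjt i z hz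
  -- the norm of `z - C i` is at most `3 ϱ i`
  have hnorm : ‖z - C i‖ ≤ 3 * ϱ i := by
    have := norm_le_abs_skewCoord_sum (z - C i)
    linarith [hz 0, hz 1, hz 2]
  rcases le_or_gt (ϱ i) (2 * ε') with hsmall | hbig
  · -- small hexagon: the centre does it
    refine ⟨t j i, hjt i, ?_⟩
    calc dist ((s j : ℂ) * hexCenter (t j i) - (s j : ℂ) * triEmbed (x j)) z
        ≤ dist ((s j : ℂ) * hexCenter (t j i) - (s j : ℂ) * triEmbed (x j)) (C i) + dist (C i) z :=
          dist_triangle _ _ _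
      _ < ε' + 3 * ϱ i := by
          have : dist (C i) z = ‖z - C i‖ := by rw [dist_comm, dist_eq_norm]
          linarith [hjc i]
      _ ≤ ε := by rw [hε'] at *; linarith
  · -- big hexagon: shrink towards the centre by the factor `1 - 2ε'/ϱ`, then take the nearest face
    have hϱ0 : 0 < ϱ i := by linarith
    set θ : ℝ := 1 - 2 * ε' / ϱ i with hθ
    have hθ0 : 0 < θ := by
      rw [hθ, sub_pos, div_lt_one hϱ0]; linarith
    have hθ1 : θ ≤ 1 := by rw [hθ]; linarith [div_nonneg (by linarith : (0:ℝ) ≤ 2 * ε') hϱ0.le]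
    set z' : ℂ := C i + (θ : ℂ) * (z - C i) with hz'
    have hz'C : ∀ ℓ : Fin 3, |skewCoord ℓ (z' - C i)| ≤ ϱ i - 2 * ε' := by
      intro ℓ
      have : z' - C i = (θ : ℂ) * (z - C i) := by rw [hz']; ring
      rw [this, skewCoord_real_mul, abs_mul, abs_of_pos hθ0]
      calc θ * |skewCoord ℓ (z - C i)| ≤ θ * ϱ i := mul_le_mul_of_nonneg_left (hz ℓ) hθ0.le
        _ = ϱ i - 2 * ε' := by rw [hθ]; field_simp
    have hzz' : dist z' z ≤ 6 * ε' := by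
      have : z' - z = ((θ - 1 : ℝ) : ℂ) * (z - C i) := by rw [hz']; push_cast; ring
      rw [dist_eq_norm, this, norm_mul, Complex.norm_real, Real.norm_eq_abs,
        show θ - 1 = -(2 * ε' / ϱ i) by rw [hθ]; ring, abs_neg, abs_of_pos (by positivity)]
      calc 2 * ε' / ϱ i * ‖z - C i‖ ≤ 2 * ε' / ϱ i * (3 * ϱ i) :=
            mul_le_mul_of_nonneg_left hnorm (by positivity)
        _ = 6 * ε' := by field_simp; ring
    obtain ⟨v, hv⟩ := exists_vertex_near (z' + (s j : ℂ) * triEmbed (x j)) (hs j)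
    have hd : dist ((s j : ℂ) * hexCenter v - (s j : ℂ) * triEmbed (x j)) z' ≤ 2 * s j := by
      have : dist ((s j : ℂ) * hexCenter v - (s j : ℂ) * triEmbed (x j)) z' =
          dist ((s j : ℂ) * hexCenter v) (z' + (s j : ℂ) * triEmbed (x j)) := by
        rw [dist_eq_norm, dist_eq_norm]; congr 1; ring
      rw [this]; exact hv
    refine ⟨v, hjp i v fun ℓ => ?_, ?_⟩
    · have := abs_skewCoord_sub_le_add ℓ ((s j : ℂ) * hexCenter v - (s j : ℂ) * triEmbed (x j)) z' (C i)
      rw [dist_comm] at hd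
      linarith [hz'C ℓ]
    · calc dist ((s j : ℂ) * hexCenter v - (s j : ℂ) * triEmbed (x j)) z
          ≤ dist ((s j : ℂ) * hexCenter v - (s j : ℂ) * triEmbed (x j)) z' + dist z' z := dist_triangle _ _ _
        _ ≤ 2 * s j + 6 * ε' := add_le_add hd hzz'
        _ < ε := by rw [hε'] at *; linarith

end Cover

/-- **Registered carrier `stub_carvedReduction_limitCover`** (crux item stmt-CriticalPhenomena-10472,
stub T-A′₂ `stub_carvedReduction_squeezeGeometry_domainsCore`, piece THE LIMIT HEXAGONS COVER AND ARE
COVERED): containment ⇒ a point every neighbourhood of which is eventually fully removed lies in a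
closed limit hexagon. -/
theorem stub_carvedReduction_limitCover :
    ∀ (N : ℕ) (s : ℕ → ℝ) (x : ℕ → Site 2) (U : ℕ → Set HexVertex) (C : Fin N → ℂ) (ϱ : Fin N → ℝ)
      (z : ℂ) (η : ℝ), (∀ j, 0 < s j) → Tendsto s atTop (𝓝 0) →
      (∀ ε > (0 : ℝ), ∀ᶠ j in atTop, ∀ v ∈ U j, ∃ i : Fin N, ∀ ℓ : Fin 3,
        |skewCoord ℓ ((s j : ℂ) * hexCenter v - (s j : ℂ) * triEmbed (x j) - C i)| ≤ ϱ i + ε) →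
      0 < η →
      (∀ᶠ j in atTop, ∀ v : HexVertex,
        dist ((s j : ℂ) * hexCenter v - (s j : ℂ) * triEmbed (x j)) z < η → v ∈ U j) →
      ∃ i : Fin N, ∀ ℓ : Fin 3, |skewCoord ℓ (z - C i)| ≤ ϱ i :=
  fun _ _ _ _ _ _ _ _ hs hs0 hcont hη hrem => mem_limitHex_of_eventually_removed_near hs hs0 hcont hη hrem

end Summit.CriticalPhenomena.SAWScalingLimit.Theorems.ObservableToSLE.TypeLadder

end
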